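import Summits.ResolutionOfSingularities.ResolutionOfSingularities.Theorems.HomologicalConductorNoZenoRMinimalResolutionGlobal
import Summits.ResolutionOfSingularities.ResolutionOfSingularities.Theorems.HomologicalConductorNoZenoMinimalityDescent
import Literature.AlgebraicGeometry.Resolution.AdicCompletionRegular
import Literature.AlgebraicGeometry.Resolution.ProjectiveSpaceRegular
import HarnessLib

/-!
# Crux `NoZenoR` (stmt-ResolutionOfSingularities-19943) — MINIMALITY LOCALISES: the base change of a minimal
# desingularization of a normal surface to the local scheme `Spec 𝒪_{Y,y}` of a closed point is again minimal
# (second half of [U] of the Castelnuovo-free road to Lipman (27.3)/(27.1))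

Route `ResolutionOfSingularities/HomologicalConductor` (cell decomp-res, hand leafhand-res-homologicalconduct-24 g0).
OURS: AI-written proof over tree theorems, weaker than expert review; nothing here is a statement of the manuscript
under review (Hironaka 2017).  SUPPORT level, counted 0.  Def-free, fact-free.

Hand 16 g4's `GlobalResolution.exists_isMinimalResolution_isBlowup_of_local` builds the GLOBAL minimal desingularization
of an integral Noetherian `Y` with finitely many non-regular closed points `Z` (each with a LOCAL minimal desingularization
that is a blowing up `Bl_{I_y}`) as `Bl_J(Y)`, `J = ∏ J_y`, `J·𝒪_{Y,y} = I_y`.  Re-running that construction and keeping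
the local bookkeeping gives:

* `exists_isMinimalResolution_isBlowup_of_local_localises` — same hypotheses, PLUS: for every closed point `y` the base
  change `Bl_J(Y) ×_Y Spec 𝒪_{Y,y} → Spec 𝒪_{Y,y}` is a MINIMAL desingularization (over `y ∈ Z` it is a blowing up of
  `I_y`, isomorphic to the given local minimal one by uniqueness of blow-ups; over a regular `y` it is a blowing up of the
  unit ideal, an isomorphism onto the regular `Spec 𝒪_{Y,y}`);
* **`IsMinimalResolution.pullback_snd_fromSpecStalk`** — hence for ANY minimal desingularization `f₀ : X₀ → Y` of such
  a `Y` (isomorphic to `Bl_J(Y)` over `Y`) and every closed point `y`, `X₀ ×_Y Spec 𝒪_{Y,y} → Spec 𝒪_{Y,y}` is minimal.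

Consumed by the hypothesis `hstep` of `…NoZenoRMinimalNoFirstKindOfStep` with `Y = Bl_𝔪 Spec S`
(`…NoZenoRMinimalOfQuadraticTransform`: the minimal desingularization of `S` is minimal for `Bl_𝔪 Spec S`).
No crux or summit statement is proved here.
-/

noncomputable section

-- single-problem summit: the doubled namespace component `ResolutionOfSingularities` is forced
set_option linter.dupNamespace false

open CategoryTheory CategoryTheory.Limits AlgebraicGeometry TopologicalSpace IsLocalRing
open Literature.AlgebraicGeometry.Resolution
open Summit.ResolutionOfSingularities.ResolutionOfSingularities.Theorems.NoZeno.ExcCount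
  (isMinimalResolution_of_iso_comp)

universe u

namespace Summit.ResolutionOfSingularities.ResolutionOfSingularities.Theorems.NoZeno.GlobalResolution

/-- **Minimality globalises AND localises.**  Under the hypotheses of `exists_isMinimalResolution_isBlowup_of_local`
(integral Noetherian `Y`, a finite set `Z` of closed non-generic points containing every non-regular point, local minimal
desingularizations of the `Spec 𝒪_{Y,y}`, `y ∈ Z`, which are blowing ups along ideals cosupported at the closed point):
`Y` has a minimal desingularization `f : X = Bl_J(Y) → Y` (`V(J) ⊆ Z`) whose base change to `Spec 𝒪_{Y,y}` is a
MINIMAL desingularization for every closed point `y`. [this work] -/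
theorem exists_isMinimalResolution_isBlowup_of_local_localises {Y : Scheme.{u}} [IsIntegral Y] [IsNoetherian Y]
    (Z : Set Y) (hZf : Z.Finite) (hZc : ∀ y ∈ Z, IsClosed ({y} : Set Y)) (hgen : genericPoint Y ∉ Z)
    (hreg : ∀ y : Y, y ∉ Z → y ∈ Scheme.regularLocus Y)
    (hloc : ∀ y ∈ Z, ∃ (Xy : Scheme.{u}) (ρ : Xy ⟶ Spec (Y.presheaf.stalk y))
      (I : (Spec (Y.presheaf.stalk y)).IdealSheafData), IsMinimalResolution ρ ∧ IsBlowup ρ I ∧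
        (I.support : Set (Spec (Y.presheaf.stalk y))) ⊆ {closedPoint (Y.presheaf.stalk y)}) :
    ∃ (X : Scheme.{u}) (f : X ⟶ Y) (J : Y.IdealSheafData),
      IsMinimalResolution f ∧ IsBlowup f J ∧ (J.support : Set Y) ⊆ Z ∧
      ∀ y : Y, IsClosed ({y} : Set Y) → IsMinimalResolution (pullback.snd f (Y.fromSpecStalk y)) := by
  classical
  -- the global ideal sheaf, exactly as in `exists_isMinimalResolution_isBlowup_of_local`
  have key : ∀ y ∈ Z, ∃ (Jy : Y.IdealSheafData), ((Jy.support : Set Y) ⊆ {y}) ∧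
      ∃ (Xy : Scheme.{u}) (ρ : Xy ⟶ Spec (Y.presheaf.stalk y)),
        IsMinimalResolution ρ ∧ IsBlowup ρ (Jy.comap (Y.fromSpecStalk y)) := by
    intro y hy
    obtain ⟨Xy, ρ, I, hρ, hρI, hI⟩ := hloc y hy
    obtain ⟨Jy, hJy, hsupp⟩ := exists_comap_fromSpecStalk_eq y (hZc y hy) I hI
    exact ⟨Jy, hsupp, Xy, ρ, hρ, by rw [hJy]; exact hρI⟩
  choose! Jf hJsupp Xf ρf hρ hρJ using key
  let T : Finset Y := hZf.toFinset
  have hTZ : ∀ y, y ∈ T ↔ y ∈ Z := fun y => Set.Finite.mem_toFinset hZf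
  obtain ⟨hJ1, hJ2, hJ3⟩ := prod_support_subset_and_comap Jf T (fun y hy => hZc y ((hTZ y).mp hy))
    (fun y hy => hJsupp y ((hTZ y).mp hy))
  let J : Y.IdealSheafData := ∏ y ∈ T, Jf y
  have hJZ : (J.support : Set Y) ⊆ Z := fun x hx => (hTZ x).mp (Finset.mem_coe.mp (hJ1 hx))
  -- blow up `J` (the companion theorem hides its `J`; we rebuild `Bl_J(Y)` and its minimality verbatim)
  obtain ⟨X₁, f₁, hf₁⟩ := exists_isBlowup Y J
  have hJ0 : J ≠ ⊥ := by
    intro h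
    apply hgen
    apply hJZ
    rw [h, Scheme.IdealSheafData.support_bot]
    trivial
  haveI : IsIntegral X₁ := hf₁.isIntegral hJ0
  haveI : IsProper f₁ := hf₁.isProper
  -- `f₁` is a desingularization: regular upstairs (local comparison with the `ρ_y`, as in the companion file)
  have hres₁ : IsResolution f₁ := by
    refine ⟨inferInstance, hf₁.isBirational' hJ0, fun x => ?_⟩
    by_cases hx : f₁ x ∈ Z
    · set y := f₁ x with hy_def
      haveI : Flat (Y.fromSpecStalk y) := flat_fromSpecStalk Y y
      have hb : IsBlowup (pullback.snd f₁ (Y.fromSpecStalk y)) ((Jf y).comap (Y.fromSpecStalk y)) := by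
        rw [← hJ2 y ((hTZ y).mpr hx)]
        exact hf₁.pullback_snd_of_flat (Y.fromSpecStalk y)
      obtain ⟨e, -, -⟩ := hb.unique (hρJ y hx)
      have hregP : Scheme.IsRegular (pullback f₁ (Y.fromSpecStalk y)) :=
        Scheme.IsRegular.of_iso e.inv (hρ y hx).1.isRegular
      obtain ⟨s, hs⟩ := mem_range_pullback_fst_fromSpecStalk_of_eq f₁ y (x' := x) rfl
      have := (mem_regularLocus_iff_pullback_fst_fromSpecStalk f₁ y s).mp (hregP s)
      rw [hs] at this
      exact this
    · haveI := hf₁.isIso_compl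
      have hxU : f₁ x ∈ (⟨(J.support : Set Y)ᶜ, J.support.isClosed.isOpen_compl⟩ : Y.Opens) :=
        fun h => hx (hJZ h)
      exact (mem_regularLocus_iff_of_isIso_morphismRestrict f₁ _ x hxU).mpr (hreg (f₁ x) hx)
  -- MINIMALITY of `f₁` (verbatim from the companion theorem): `J·𝒪_W` is an effective Cartier ideal
  have hf₁min : IsMinimalResolution f₁ := by
    refine ⟨hres₁, fun W g hg => ?_⟩
    haveI : IsProper g := hg.isProper
    haveI : IsIntegral W := hg.isIntegral_source
    haveI : IsNoetherian W := by
      haveI : IsLocallyNoetherian W := LocallyOfFiniteType.isLocallyNoetherian g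
      haveI : CompactSpace W := QuasiCompact.compactSpace_of_compactSpace g
      exact {}
    have hJg0 : J.comap g ≠ ⊥ := by
      intro h
      haveI : IsDominant g := hg.isBirational.isDominant
      have hgen' : g (genericPoint W) = genericPoint Y := by
        have h1 := (genericPoint_spec W).image g.continuous
        rw [Set.image_univ, g.denseRange.closure_range] at h1
        exact h1.eq (by simpa using genericPoint_spec Y)
      have hmem : genericPoint W ∈ ((J.comap g).support : Set W) := by
        rw [h, Scheme.IdealSheafData.support_bot]; trivial
      rw [Scheme.IdealSheafData.support_comap] at hmem
      exact hgen (hJZ (by simpa [hgen'] using hmem))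
    have hLP : IsLocallyPrincipal (J.comap g) := by
      intro w
      by_cases hw : g w ∈ Z
      · set y := g w with hy_def
        haveI : Flat (Y.fromSpecStalk y) := flat_fromSpecStalk Y y
        have hgy : IsResolution (pullback.snd g (Y.fromSpecStalk y)) := hg.pullback_snd_fromSpecStalk y
        obtain ⟨k, hk⟩ := (hρ y hw).2 _ _ hgy
        haveI : IsProper (ρf y hw) := (hρ y hw).1.isProper
        haveI : IsLocallyNoetherian (Xf y hw) := LocallyOfFiniteType.isLocallyNoetherian (ρf y hw)
        obtain ⟨s, hs⟩ := mem_range_pullback_fst_fromSpecStalk_of_eq g y (x' := w) rfl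
        haveI := isIso_stalkMap_pullback_fst_fromSpecStalk g y s
        rw [isLocallyPrincipalAt_iff_isPrincipal_stalkIdeal, ← hs]
        refine isPrincipal_stalkIdeal_of_comap_of_isIso_stalkMap (pullback.fst g (Y.fromSpecStalk y)) (J.comap g) s ?_
        have hcomap : (J.comap g).comap (pullback.fst g (Y.fromSpecStalk y)) =
            (((Jf y).comap (Y.fromSpecStalk y)).comap (ρf y hw)).comap k := by
          rw [← Scheme.IdealSheafData.comap_comp, pullback.condition, Scheme.IdealSheafData.comap_comp,
            hJ2 y ((hTZ y).mpr hw), ← Scheme.IdealSheafData.comap_comp, ← Scheme.IdealSheafData.comap_comp, hk,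
            Scheme.IdealSheafData.comap_comp]
        rw [hcomap]
        refine isPrincipal_stalkIdeal_comap_of_isPrincipal k _ s ?_
        exact (isLocallyPrincipalAt_iff_isPrincipal_stalkIdeal _ _).mp
          ((hρJ y hw).isEffectiveCartier.isLocallyPrincipal (k s))
      · refine isLocallyPrincipalAt_of_not_mem_support fun h => hw (hJZ ?_)
        rw [Scheme.IdealSheafData.support_comap] at h
        exact h
    obtain ⟨k, hk, -⟩ := hf₁.universal g (hLP.isEffectiveCartier_of_ne_bot hJg0)
    exact ⟨k, hk⟩
  refine ⟨X₁, f₁, J, hf₁min, hf₁, hJZ, fun y hyc => ?_⟩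
  -- LOCALISATION at a closed point `y`
  haveI : Flat (Y.fromSpecStalk y) := flat_fromSpecStalk Y y
  haveI : IsNoetherian X₁ := by
    haveI : IsLocallyNoetherian X₁ := LocallyOfFiniteType.isLocallyNoetherian f₁
    haveI : CompactSpace X₁ := QuasiCompact.compactSpace_of_compactSpace f₁
    exact {}
  have hres_y : IsResolution (pullback.snd f₁ (Y.fromSpecStalk y)) := hres₁.pullback_snd_fromSpecStalk y
  by_cases hy : y ∈ Z
  · -- over `y ∈ Z`: a blowing up of `I_y`, isomorphic to the local minimal `ρ_y`
    have hb : IsBlowup (pullback.snd f₁ (Y.fromSpecStalk y)) ((Jf y).comap (Y.fromSpecStalk y)) := by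
      rw [← hJ2 y ((hTZ y).mpr hy)]
      exact hf₁.pullback_snd_of_flat (Y.fromSpecStalk y)
    obtain ⟨e, he, -⟩ := hb.unique (hρJ y hy)
    haveI : IsIso e.hom := e.isIso_hom
    exact isMinimalResolution_of_iso_comp (hρ y hy) e.hom he hres_y
  · -- over a regular `y ∉ Z`: a blowing up of the unit ideal, an isomorphism onto the regular `Spec 𝒪_{Y,y}`
    have hb : IsBlowup (pullback.snd f₁ (Y.fromSpecStalk y)) ⊤ := by
      rw [← hJ3 y hyc (fun h => hy ((hTZ y).mp h))]
      exact hf₁.pullback_snd_of_flat (Y.fromSpecStalk y)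
    haveI : IsIso (pullback.snd f₁ (Y.fromSpecStalk y)) := hb.isIso isEffectiveCartier_top
    have hyreg : IsRegularLocalRing (Y.presheaf.stalk y) := hreg y hy
    haveI : IsRegularRing (Y.presheaf.stalk y) := isRegularRing_of_isRegularLocalRing _
    have hSreg : Scheme.IsRegular (Spec (Y.presheaf.stalk y)) := Scheme.isRegular_Spec _
    exact isMinimalResolution_of_iso_comp (isMinimalResolution_id hSreg) (pullback.snd f₁ (Y.fromSpecStalk y))
      (Category.comp_id _) hres_y

/-- **The base change of ANY minimal desingularization to `Spec 𝒪_{Y,y}` is minimal** (`Y` integral Noetherian with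
finitely many non-regular closed points `Z` as above; `y` any closed point): the minimal desingularization is unique up
to a `Y`-isomorphism (`IsMinimalResolution.isIso_of_comp_eq`), isomorphic base changes have the same minimality, and for
`Bl_J(Y)` it is `exists_isMinimalResolution_isBlowup_of_local_localises`. [this work] -/
theorem IsMinimalResolution.pullback_snd_fromSpecStalk {Y : Scheme.{u}} [IsIntegral Y] [IsNoetherian Y]
    (Z : Set Y) (hZf : Z.Finite) (hZc : ∀ y ∈ Z, IsClosed ({y} : Set Y)) (hgen : genericPoint Y ∉ Z)
    (hreg : ∀ y : Y, y ∉ Z → y ∈ Scheme.regularLocus Y)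
    (hloc : ∀ y ∈ Z, ∃ (Xy : Scheme.{u}) (ρ : Xy ⟶ Spec (Y.presheaf.stalk y))
      (I : (Spec (Y.presheaf.stalk y)).IdealSheafData), IsMinimalResolution ρ ∧ IsBlowup ρ I ∧
        (I.support : Set (Spec (Y.presheaf.stalk y))) ⊆ {closedPoint (Y.presheaf.stalk y)})
    {X₀ : Scheme.{u}} {f₀ : X₀ ⟶ Y} (hf₀ : IsMinimalResolution f₀) (y : Y) (hyc : IsClosed ({y} : Set Y)) :
    IsMinimalResolution (pullback.snd f₀ (Y.fromSpecStalk y)) := by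
  obtain ⟨X, f, J, hfmin, -, -, hlocal⟩ :=
    exists_isMinimalResolution_isBlowup_of_local_localises Z hZf hZc hgen hreg hloc
  -- `X₀ ≅ X` over `Y`
  obtain ⟨k, hk⟩ := hfmin.2 X₀ f₀ hf₀.1
  haveI : IsIso k := hf₀.isIso_of_comp_eq hfmin k hk
  -- the induced isomorphism of base changes
  let h : pullback f₀ (Y.fromSpecStalk y) ⟶ pullback f (Y.fromSpecStalk y) :=
    pullback.map f₀ (Y.fromSpecStalk y) f (Y.fromSpecStalk y) k (𝟙 _) (𝟙 _)
      (by rw [Category.comp_id, hk]) (by rw [Category.comp_id, Category.id_comp])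
  have hh : h ≫ pullback.snd f (Y.fromSpecStalk y) = pullback.snd f₀ (Y.fromSpecStalk y) := by
    simp only [h, pullback.map, pullback.lift_snd, Category.comp_id]
  haveI : IsIntegral X₀ := hf₀.1.isIntegral_source
  haveI : IsProper f₀ := hf₀.1.isProper
  haveI : NoetherianSpace X₀ := by
    haveI : IsLocallyNoetherian X₀ := LocallyOfFiniteType.isLocallyNoetherian f₀
    haveI : CompactSpace X₀ := QuasiCompact.compactSpace_of_compactSpace f₀
    haveI : IsNoetherian X₀ := {}
    infer_instance
  have hres₀ : IsResolution (pullback.snd f₀ (Y.fromSpecStalk y)) := hf₀.1.pullback_snd_fromSpecStalk y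
  exact isMinimalResolution_of_iso_comp (hlocal y hyc) h hh hres₀

end Summit.ResolutionOfSingularities.ResolutionOfSingularities.Theorems.NoZeno.GlobalResolution

end
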